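import Summits.BirchSwinnertonDyer.BirchSwinnertonDyer.Theorems.RamifiedSevenEllipticUnitsTwoGeneratorDescent
import Summits.BirchSwinnertonDyer.BirchSwinnertonDyer.Theorems.RamifiedSevenEllipticUnitsRelaxedSelmerSaturation
import Summits.BirchSwinnertonDyer.BirchSwinnertonDyer.Theorems.RamifiedSevenEllipticUnitsBottomLocalIndexSplit
import Summits.BirchSwinnertonDyer.BirchSwinnertonDyer.Theorems.RamifiedSevenEllipticUnitsEllipticUnitValueSevenOfGZKStubLocalMordellWeilDictSevenZp
import Literature.NumberTheory.EllipticCurves.CompactSelmerKummerDescentFG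
import Literature.NumberTheory.EllipticCurves.EndomorphismRingTwoGenerated
import Literature.NumberTheory.EllipticCurves.MordellWeilTheoremProofs
import Summits.BirchSwinnertonDyer.Rank1Residual.X12.O11.RamifiedRubinFormulaLineZp
import Summits.BirchSwinnertonDyer.BirchSwinnertonDyer.Theses.RamifiedSevenEllipticUnits
import HarnessLib

set_option linter.dupNamespace false
set_option autoImplicit false

/-!
# K7r crux `EllipticUnitValueSevenOfGZK` (stmt-BirchSwinnertonDyer-19945), line `rubin-formula-zp`:
# the stub S_sat-Zp BY THE RANK ROUTE — `S_{p,rel}(E/K) ≤ E(K) ⊗ ℤ_p` at every pinned O11 datum with a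
# bottom index exponent, MODULO the named fact «`End_K(E)` is two-generated» (Silverman AEC III.9.4,
# `endRing_twoGenerated`); no Ш, no GZK, no global duality, no reciprocity law
# (cell `bsd-cm`, seat `bsd-cm-k7r-c4` g6; `--supports` 19945)

HONEST FRAMING. The registered stub `stub_bottomSaturationSevenZpOfGZK` (`GZK → ∀ W ∈ 𝒞₇, S_sat-Zp W 7`)
is NOT closed by this file: the closer here carries the published-but-unformalised input
`Literature.NumberTheory.EllipticCurves.endRing_twoGenerated` (F2) as an explicit antecedent
(`bottomSaturationSevenZp_of_endTwoGenerated : F2 → GZK → ∀ W, ClassCSeven W → …AtZp W 7`); it becomes a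
by-name closer only if the planner threads F2 into the crux's antecedent. Nothing about any curve is
asserted; BSD is not proved; a closed item would close a rung leaf of BirchSwinnertonDyer at most.

THE ARGUMENT (memo MEMO-k7r-c4-g6-CONTINUATION.md §4; abstract core `TwoGeneratorDescent`, p477771).
At the bottom layer `H = Γ_K` of an O11 frame, with `M = E(K) ⊗ ℤ_p` (`mordellWeilKummerSpan`),
`S = S_{p,rel}(E/K)`, `T` = torsion of `∏_k H¹(K, E[p^k])`:
(1) `M ≤ S` (p464144); (2) `M` is `ℤ_p`-stable (p465731) and SATURATED in `S`: `N·x ∈ M`, `x ∈ S` ⇒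
`x ∈ S_p` (p466833) and the `H¹(K, E)`-images `y_k` of the `x_k` satisfy `y_k = p·y_{k+1}`, `p^k y_k = 0`,
`N y_k = 0`, so vanish (Tate tower, p466833) — NO finiteness of `Ш` — whence `x` is levelwise Kummer and
lies in `M` by the compact Kummer descent (k8i-c2 g8, p473565/p474926) and Mordell–Weil
(`module_finite_point_holds`); (3) by F2, `𝒪_𝔭·z(𝟙) ≤ ℤ_p z₁ + ℤ_p z₂` (`z_i = φ_i·z(𝟙)`), so
`hcZp : [S : T ⊔ 𝒪_𝔭·z(𝟙)] = p^c` gives `p^c • a ∈ T + ℤ_p z₁ + ℤ_p z₂` for every `a ∈ S`; (4) the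
`±`-chart of k7r-c3 (p469137/p473177: `Φ : E(K_𝔭) ↠ ℤ_p²`, torsion kernel; `E(K_𝔭) ⊗ ℤ_p` torsion-free;
the chart detects `ℤ_p`-relations) makes the Kummer families of `P_K` and of the twist `T_{P'}`
`ℤ_p`-independent modulo torsion; (5) `TwoGeneratorDescent.le_of_twoGenerator_descent` ⇒ `S ≤ M`.

References: B. Perrin-Riou, Bull. SMF 115 (1987) §0 pp. 401–402; J. H. Silverman, *AEC* (2009)
Cor. III.9.4, Ex. 10.16, VIII.§2; [BKNO] arXiv:2608.06879v1 §3.1.2, §3.3.1 (objects only).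
-/

noncomputable section

open scoped Classical

open WeierstrassCurve NumberField IsDedekindDomain Field
  Literature.NumberTheory.EllipticCurves
  Literature.NumberTheory.GaloisRepresentations
  Literature.NumberTheory.EllipticCurves.BurungaleKobayashiNakamuraOta2026
  Summit.BirchSwinnertonDyer.Rank1Residual

universe u

namespace Summit.BirchSwinnertonDyer.BirchSwinnertonDyer.Theorems.RamifiedSevenEllipticUnits

namespace BottomSaturationRank

/-! ## §1 `ℤ`-bilinearity of the `End_K(E)`-action on families -/

section EndLinear

variable {F : Type u} [Field F] (V : WeierstrassCurve F) (p : ℕ) (H : Subgroup (absoluteGaloisGroup F))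

/-- **If `φ = a φ₁ + b φ₂` pointwise on `E(F̄)`, then `φ·x = a•(φ₁·x) + b•(φ₂·x)` on families**
(`endPi` is the map of the compatible pair `(id, φ|_{E[p^k]})` levelwise; classes of pushed-forward
cocycles add). [cite: SilvermanAEC2009, III.4 (`End(E)` acts additively) and VIII.§2] -/
theorem endPi_eq_zsmul_add_zsmul {φ φ₁ φ₂ : AddMonoid.End V.geomPoints} (hφ : φ ∈ V.endRing)
    (hφ₁ : φ₁ ∈ V.endRing) (hφ₂ : φ₂ ∈ V.endRing) (a b : ℤ)
    (h : ∀ P : V.geomPoints, φ P = a • φ₁ P + b • φ₂ P) (x : V.torsionH1Pi p H) :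
    V.endPi hφ p H x = a • V.endPi hφ₁ p H x + b • V.endPi hφ₂ p H x := by
  funext k
  simp only [WeierstrassCurve.endPi, AddMonoidHom.pi_apply, AddMonoidHom.coe_comp, Function.comp_apply,
    Pi.evalAddMonoidHom_apply, Pi.add_apply, Pi.smul_apply]
  obtain ⟨f, hf⟩ := oneCocycleClass_surjective (discreteTopRep H (geomTorsion V ((p : ℤ) ^ k))) (x k)
  set X := discreteTopRep H (geomTorsion V ((p : ℤ) ^ k)) with hX
  -- integer multiples of classes are classes of integer multiples (additivity of the class map)
  have hz : ∀ (n : ℤ) (g : contOneCocycles X), n • oneCocycleClass X g = oneCocycleClass X (n • g) := by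
    intro n g
    rw [← oneCocycleClassₗ_apply, ← oneCocycleClassₗ_apply, map_zsmul]
  rw [← hf, WeierstrassCurve.endH1, WeierstrassCurve.endH1, WeierstrassCurve.endH1,
    resH1Hom_oneCocycleClass, resH1Hom_oneCocycleClass, resH1Hom_oneCocycleClass, hz, hz,
    ← oneCocycleClass_add]
  congr 1
  refine Subtype.ext (ContinuousMap.ext fun σ ↦ Subtype.ext ?_)
  have e1 : ∀ (n : ℤ) (g : contOneCocycles X) (τ : H), ((n • g).1 τ : geomTorsion V ((p : ℤ) ^ k)) =
      n • (g.1 τ) := fun n g τ ↦ by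
    rw [AddSubgroupClass.coe_zsmul, ContinuousMap.coe_zsmul, Pi.smul_apply]
  have e2 : ∀ (g g' : contOneCocycles X) (τ : H), ((g + g').1 τ : geomTorsion V ((p : ℤ) ^ k)) =
      g.1 τ + g'.1 τ := fun g g' τ ↦ by
    rw [Submodule.coe_add, ContinuousMap.add_apply]
  rw [e2, e1, e1, AddSubgroup.coe_add, AddSubgroupClass.coe_zsmul, AddSubgroupClass.coe_zsmul,
    pullback_resHomOfEquivariant_apply, pullback_resHomOfEquivariant_apply,
    pullback_resHomOfEquivariant_apply]
  exact h _

end EndLinear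

/-! ## §2 Mordell–Weil Kummer classes die in `H¹(K, E)`; `E(K) ⊗ ℤ_p` is saturated among compatible families -/

section Saturation

variable {F : Type u} [Field F] (V : WeierstrassCurve F) [V.IsElliptic] (p : ℕ) [Fact p.Prime]
  (H : Subgroup (absoluteGaloisGroup F))

/-- Every component of a Mordell–Weil Kummer class dies in `H¹(H, E(F̄))` (generators `c·κ(P)`:
`(c·κ(P))_k` is an integer multiple of a Kummer class, killed by `torsionToGeomH1Over`).
[cite: SilvermanAEC2009, VIII.§2 (the Kummer sequence)] -/
theorem torsionToGeomH1Over_apply_eq_zero_of_mem_mordellWeilKummerSpan {x : V.torsionH1Pi p H}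
    (hx : x ∈ V.mordellWeilKummerSpan p H) (k : ℕ) :
    V.torsionToGeomH1Over ((p : ℤ) ^ k) H (x k) = 0 := by
  unfold mordellWeilKummerSpan at hx
  rw [kummerSpan_eq_closure_kummerFamily] at hx
  induction hx using AddSubgroup.closure_induction with
  | mem y hy =>
    obtain ⟨P, hPS, c, rfl⟩ := hy
    have hpk : ((p : ℤ) ^ k) ≠ 0 := pow_ne_zero _ (Int.natCast_ne_zero.mpr (Fact.out : p.Prime).ne_zero)
    obtain ⟨Q, hQ⟩ := V.zsmul_geomPoints_surjective_holds hpk P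
    rw [BottomLocalIndexSplit.padicPi_apply, map_nsmul,
      V.isKummerFamilyOver_kummerFamily p H _ k Q hQ, torsionToGeomH1Over_kummerClassOver, smul_zero]
  | zero => rw [Pi.zero_apply, map_zero]
  | add y z _ _ hy hz => rw [Pi.add_apply, map_add, hy, hz, add_zero]
  | neg y _ hy => rw [Pi.neg_apply, map_neg, hy, neg_zero]

/-- **`E(L) ⊗ ℤ_p` is SATURATED among compatible families** (no finiteness of `Ш` needed): if `x` is
`p`-compatible, `E(L)` is finitely generated and `N • x ∈ E(L) ⊗ ℤ_p` for an integer `N ≠ 0`, then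
`x ∈ E(L) ⊗ ℤ_p` — the `H¹(H, E(F̄))`-images `y_k` of the `x_k` form a `p`-divisible tower of
`p^k`-torsion elements killed by `N`, hence vanish (`RelaxedSelmerSaturation.eq_zero_of_tower`), so `x` is
levelwise Kummer and the compact Kummer descent applies. [cite: PerrinRiou1987BSMF, §0 pp. 401–402 (`0 → E(L) ⊗ ℤ_p → S_p(L) → T_pШ → 0`)]
[cite: Howard2004HeegnerKolyvagin, §1 (descent sequence for S_p(E/L))] -/
theorem mem_mordellWeilKummerSpan_of_zsmul_mem (hfg : Module.Finite ℤ (V.fixedGeomPoints H))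
    {x : V.torsionH1Pi p H} (hx : x ∈ V.compatiblePi H p) {N : ℤ} (hN : N ≠ 0)
    (hNx : N • x ∈ V.mordellWeilKummerSpan p H) : x ∈ V.mordellWeilKummerSpan p H := by
  have hcomp := V.mem_compatiblePi_iff.1 hx
  have hy : ∀ k, V.torsionToGeomH1Over ((p : ℤ) ^ k) H (x k) = 0 := by
    refine RelaxedSelmerSaturation.eq_zero_of_tower (Fact.out : p.Prime)
      (fun k ↦ V.torsionToGeomH1Over ((p : ℤ) ^ k) H (x k)) (fun k ↦ ?_) (fun k ↦ ?_) hN (fun k ↦ ?_)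
    · rw [← hcomp k, torsionToGeomH1Over_reduceTorsionH1]
    · rw [← map_nsmul, ← natCast_zsmul, Nat.cast_pow, pow_smul_torsionH1Over_eq_zero, map_zero]
    · rw [← map_zsmul, ← Pi.smul_apply]
      exact torsionToGeomH1Over_apply_eq_zero_of_mem_mordellWeilKummerSpan V p H hNx k
  exact V.mem_mordellWeilKummerSpan_of_pow_smul_torsionToGeomH1Over_eq_zero_of_moduleFinite hfg hx 0
    (fun k ↦ by rw [hy k, smul_zero])

end Saturation

/-! ## §3 Two Mordell–Weil Kummer classes independent modulo torsion (the `±`-chart of k7r-c3) -/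

section Independence

/-- **At an O11 frame, `E(K) ⊗ ℤ_p` contains two classes `ℤ_p`-independent modulo torsion** — the
Kummer families of `P_K` (`P ∈ E(ℚ)` of infinite order) and of the twist `T_{P'}` of `P' ∈ E'(ℚ)`: a
torsion `ℤ_p`-combination localises into `E(K_𝔭) ⊗ ℤ_p` (torsion-free, k7r-c3
`localKummer_torsionFree_and_chart_detects`), hence to `0`, and the chart reads off
`(u·λ(P), v·λ'(P')) = 0` with `λ(P), λ'(P') ≠ 0`. [cite: SilvermanAEC2009, Exercise 10.16 and Prop. VII.6.3]
[cite: PerrinRiou1987BSMF, §0 p. 401] -/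
theorem exists_pair_indep (W : WeierstrassCurve ℚ) [W.IsElliptic] [W.IsGloballyMinimal] (p : ℕ)
    [Fact p.Prime] {K : Type} [Field K] [NumberField K] {𝔭 : HeightOneSpectrum (𝓞 K)}
    {W' : WeierstrassCurve ℚ} [W'.IsElliptic] [W'.IsGloballyMinimal] {C : VariableChange ℚ}
    (hF : X12.O11.IsFrame W p K 𝔭 W' C) {P : W.toAffine.Point} (hP : ¬ IsOfFinAddOrder P)
    {P' : W'.toAffine.Point} (hP' : ¬ IsOfFinAddOrder P')
    (H : Subgroup (absoluteGaloisGroup K)) (hH : H = ⊤) :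
    ∃ m₁ ∈ (W.baseChange K).mordellWeilKummerSpan p H, ∃ m₂ ∈ (W.baseChange K).mordellWeilKummerSpan p H,
      ∀ u v : ℤ_[p], IsOfFinAddOrder ((W.baseChange K).padicPi p H u m₁ + (W.baseChange K).padicPi p H v m₂) →
        u = 0 ∧ v = 0 := by
  subst hH
  have hp : p.Prime := Fact.out
  -- the chart at the frame and its by-products
  obtain ⟨Φ, lam, lam', u₀, hΦ0, hΦs, hlam0, -, hlam'0, -, -, hV1, hV2, -⟩ :=
    KummerCore.exists_frameChart W p hF
  haveI : NoZeroSMulDivisors ℤ_[p] (ℤ_[p] × ℤ_[p]) := KummerCore.noZeroSMulDivisors_prod_padicInt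
  haveI : CharZero (𝔭.adicCompletion K) :=
    charZero_of_injective_algebraMap (algebraMap K (𝔭.adicCompletion K)).injective
  have hE := noPTorsion_adicCompletion_of_isFrame W p hF
  obtain ⟨htf, hdet⟩ := KummerCore.localKummer_torsionFree_and_chart_detects (W.baseChange K)
    (closureEmb (K := K) (𝔭.adicCompletion K)) p Φ hΦ0 hΦs KummerCore.prod_padicInt_separated hE
  set bc : (W.baseChange K).toAffine.Point →+
      ((W.baseChange K).baseChange (𝔭.adicCompletion K)).toAffine.Point :=
    Affine.Point.baseChange (W' := W.baseChange K) K (𝔭.adicCompletion K) with hbc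
  -- the generators in the chart are non-zero
  have hx₁ : lam (W.toPadicPoint p P) ≠ 0 := fun h ↦ hP
    (((Affine.Point.map_injective (W' := W) (Algebra.ofId ℚ ℚ_[p])).isOfFinAddOrder_iff
      (f := W.toPadicPoint p)).1 ((hlam0 _).1 h))
  have hx₂ : lam' (W'.toPadicPoint p P') ≠ 0 := fun h ↦ hP'
    (((Affine.Point.map_injective (W' := W') (Algebra.ofId ℚ ℚ_[p])).isOfFinAddOrder_iff
      (f := W'.toPadicPoint p)).1 ((hlam'0 _).1 h))
  -- the two points `P_K`, `T₂` of `E(K)` and their Kummer families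
  set PK : (W.baseChange K).toAffine.Point := Affine.Point.baseChange (W' := W) ℚ K P with hPK
  obtain ⟨T₂, hT₂⟩ := hV2 P'
  have hV1P := hV1 P
  set mP : (W.baseChange K).fixedGeomPoints ⊤ :=
    ⟨toGeomPoints (W.baseChange K) PK, KummerCore.toGeomPoints_mem_fixedGeomPoints W ⊤ PK⟩ with hmP
  set mT : (W.baseChange K).fixedGeomPoints ⊤ :=
    ⟨toGeomPoints (W.baseChange K) T₂, KummerCore.toGeomPoints_mem_fixedGeomPoints W ⊤ T₂⟩ with hmT
  have hmem : ∀ (m : (W.baseChange K).fixedGeomPoints ⊤) (c : ℤ_[p]),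
      (W.baseChange K).padicPi p ⊤ c ((W.baseChange K).kummerFamily p ⊤ m) ∈
        (W.baseChange K).mordellWeilKummerSpan p ⊤ := fun m c ↦
    (W.baseChange K).padicPi_mem_kummerSpan p ⊤ _ m.2 c ((W.baseChange K).isKummerFamilyOver_kummerFamily p ⊤ m)
  have hone : ∀ m : (W.baseChange K).fixedGeomPoints ⊤,
      (W.baseChange K).kummerFamily p ⊤ m ∈ (W.baseChange K).mordellWeilKummerSpan p ⊤ := fun m ↦ by
    have h := hmem m 1
    rwa [padicPi_one] at h
  -- localisation of the two Kummer families
  have hlocfam : ∀ R : (W.baseChange K).toAffine.Point,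
      (W.baseChange K).localTorsionResPi (closureEmb (K := K) (𝔭.adicCompletion K)) p ⊤
        ((W.baseChange K).kummerFamily p ⊤
          ⟨toGeomPoints (W.baseChange K) R, KummerCore.toGeomPoints_mem_fixedGeomPoints W ⊤ R⟩) =
      ((W.baseChange K).baseChange (𝔭.adicCompletion K)).kummerFamily p
        (localSubgroupOfEmb ⊤ (closureEmb (K := K) (𝔭.adicCompletion K)))
        ⟨toGeomPoints ((W.baseChange K).baseChange (𝔭.adicCompletion K)) (bc R),
          KummerCore.toGeomPoints_mem_fixedGeomPoints (W.baseChange K) _ (bc R)⟩ := by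
    intro R
    have hfix : ∀ σ ∈ (⊤ : Subgroup (absoluteGaloisGroup K)),
        σ • toGeomPoints (W.baseChange K) R = toGeomPoints (W.baseChange K) R :=
      ((W.baseChange K).mem_fixedGeomPoints_iff _).1 (KummerCore.toGeomPoints_mem_fixedGeomPoints W ⊤ R)
    rw [IsKummerFamilyOver.eq_kummerFamily p
      ((W.baseChange K).smul_geomPointsMapOfEmb_of_fixed (closureEmb (K := K) (𝔭.adicCompletion K)) ⊤ hfix)
      (IsKummerFamilyOver.localTorsionResPi (W.baseChange K) (closureEmb (K := K) (𝔭.adicCompletion K))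
        p ⊤ hfix ((W.baseChange K).isKummerFamilyOver_kummerFamily p ⊤
          ⟨toGeomPoints (W.baseChange K) R, KummerCore.toGeomPoints_mem_fixedGeomPoints W ⊤ R⟩))]
    congr 1
    exact Subtype.ext (KummerCore.geomPointsMapOfEmb_toGeomPoints (W.baseChange K) _ R)
  refine ⟨(W.baseChange K).kummerFamily p ⊤ mP, hone mP, (W.baseChange K).kummerFamily p ⊤ mT, hone mT,
    fun u v huv ↦ ?_⟩
  -- a torsion combination localises to `0`
  set y := (W.baseChange K).padicPi p ⊤ u ((W.baseChange K).kummerFamily p ⊤ mP) +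
    (W.baseChange K).padicPi p ⊤ v ((W.baseChange K).kummerFamily p ⊤ mT) with hy
  have hyM : y ∈ (W.baseChange K).mordellWeilKummerSpan p ⊤ := AddSubgroup.add_mem _ (hmem mP u) (hmem mT v)
  have hyB : (W.baseChange K).localTorsionResPi (closureEmb (K := K) (𝔭.adicCompletion K)) p ⊤ y ∈
      (W.baseChange K).localKummerCompactOfEmb (closureEmb (K := K) (𝔭.adicCompletion K)) p ⊤ :=
    (W.baseChange K).map_localTorsionResPi_mordellWeilKummerSpan_le _ p ⊤ ⟨y, hyM, rfl⟩
  have hytors : (W.baseChange K).localTorsionResPi (closureEmb (K := K) (𝔭.adicCompletion K)) p ⊤ y ∈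
      AddCommGroup.torsion _ :=
    (AddCommGroup.mem_torsion _).2 (AddMonoidHom.isOfFinAddOrder _ huv)
  have hloc0 : (W.baseChange K).localTorsionResPi (closureEmb (K := K) (𝔭.adicCompletion K)) p ⊤ y = 0 := by
    have h := AddSubgroup.mem_inf.2 ⟨hytors, hyB⟩
    rwa [htf, AddSubgroup.mem_bot] at h
  rw [hy, map_add, localTorsionResPi_padicPi, localTorsionResPi_padicPi, hmP, hmT, hlocfam PK,
    hlocfam T₂] at hloc0
  have huv' := hdet (bc PK) (bc T₂) u v hloc0
  have e1 : Φ (bc PK) = (lam (W.toPadicPoint p P), 0) := hV1P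
  have e2 : Φ (bc T₂) = (0, lam' (W'.toPadicPoint p P')) := hT₂
  rw [e1, e2, Prod.smul_mk, Prod.smul_mk, Prod.mk_add_mk, Prod.mk_eq_zero, smul_zero, smul_zero,
    add_zero, zero_add, smul_eq_mul, smul_eq_mul] at huv'
  exact ⟨(mul_eq_zero.1 huv'.1).resolve_right hx₁, (mul_eq_zero.1 huv'.2).resolve_right hx₂⟩

end Independence

/-! ## §4 The bottom index exponent and the two `End_K(E)`-generators: `p^c • a ∈ tors + ℤ_p z₁ + ℤ_p z₂` -/

section IndexExpansion

variable {F : Type u} [Field F] (V : WeierstrassCurve F) (p : ℕ) [Fact p.Prime]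
  (H : Subgroup (absoluteGaloisGroup F))

/-- The `p`-adic `End_K(E)`-span of `x` lies in `ℤ_p · (φ₁ x) + ℤ_p · (φ₂ x)` when every `K`-rational
endomorphism is `a φ₁ + b φ₂` pointwise (F2). [cite: SilvermanAEC2009, Cor. III.9.4 (shape only)]
[cite: BurungaleKobayashiNakamuraOta2026, §3.3.1 (arXiv:2608.06879 p. 19) (the module `𝒪·z`; shape only)] -/
theorem exists_eq_padicPi_add_of_mem_padicEndSpan {φ₁ φ₂ : AddMonoid.End V.geomPoints}
    (hφ₁ : φ₁ ∈ V.endRing) (hφ₂ : φ₂ ∈ V.endRing)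
    (hgen : ∀ φ ∈ V.endRing, ∃ a b : ℤ, ∀ P : V.geomPoints, φ P = a • φ₁ P + b • φ₂ P)
    (x : V.torsionH1Pi p H) {y : V.torsionH1Pi p H} (hy : y ∈ V.padicEndSpan p H x) :
    ∃ u v : ℤ_[p], y = V.padicPi p H u (V.endPi hφ₁ p H x) + V.padicPi p H v (V.endPi hφ₂ p H x) := by
  have hadd := BottomLocalIndexSplit.padicPi_add V p H
  have h1 : ∀ z : V.torsionH1Pi p H, V.padicPi p H 1 z = z := padicPi_one V p H
  unfold padicEndSpan at hy
  induction hy using AddSubgroup.closure_induction with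
  | mem y hy =>
    obtain ⟨φ, hφ, c, rfl⟩ := hy
    obtain ⟨a, b, hab⟩ := hgen φ hφ
    refine ⟨c * a, c * b, ?_⟩
    rw [endPi_eq_zsmul_add_zsmul V p H hφ hφ₁ hφ₂ a b hab, map_add,
      ← TwoGeneratorDescent.act_intCast (V.padicPi p H) hadd h1 a,
      ← TwoGeneratorDescent.act_intCast (V.padicPi p H) hadd h1 b, padicPi_padicPi, padicPi_padicPi]
  | zero =>
    exact ⟨0, 0, by rw [TwoGeneratorDescent.act_zero (V.padicPi p H) hadd,
      TwoGeneratorDescent.act_zero (V.padicPi p H) hadd, add_zero]⟩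
  | add y z _ _ hy hz =>
    obtain ⟨u₁, v₁, rfl⟩ := hy
    obtain ⟨u₂, v₂, rfl⟩ := hz
    exact ⟨u₁ + u₂, v₁ + v₂, by rw [hadd, hadd]; abel⟩
  | neg y _ hy =>
    obtain ⟨u, v, rfl⟩ := hy
    exact ⟨-u, -v, by rw [TwoGeneratorDescent.act_neg (V.padicPi p H) hadd,
      TwoGeneratorDescent.act_neg (V.padicPi p H) hadd]; abel⟩

end IndexExpansion

/-! ## §5 Assembly: `S_{p,rel}(E/K) ≤ E(K) ⊗ ℤ_p` at a pinned O11 datum, modulo F2 -/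

section Assembly

/-- **Mordell–Weil at the bottom layer in compact currency**: `E(K) = E(K̄)^{Γ_K}` is a finite
`ℤ`-module (Galois descent + the Mordell–Weil theorem `module_finite_point_holds`).
[cite: SilvermanAEC2009, Thm. VIII.6.7 and VIII.§1 (proof of Prop. 1.2)] -/
theorem moduleFinite_fixedGeomPoints_top {K : Type} [Field K] [NumberField K] (V : WeierstrassCurve K)
    [V.IsElliptic] (H : Subgroup (absoluteGaloisGroup K)) (hH : H = ⊤) :
    Module.Finite ℤ (V.fixedGeomPoints H) := by
  subst hH
  haveI : Module.Finite ℤ V.toAffine.Point := V.module_finite_point_holds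
  set j : V.toAffine.Point →+ V.fixedGeomPoints ⊤ :=
    (toGeomPoints V).codRestrict _ (fun R ↦ (V.mem_fixedGeomPoints_iff _).2 fun σ _ ↦ smul_toGeomPoints _ σ R)
    with hj
  refine Module.Finite.of_surjective j.toIntLinearMap fun m ↦ ?_
  obtain ⟨R, hR⟩ := KummerCore.exists_toGeomPoints_eq_of_mem_fixedGeomPoints_top' V m.2
  exact ⟨R, Subtype.ext hR⟩

/-- **S_sat-Zp BY THE RANK ROUTE (modulo F2).** At an O11 frame `(K, 𝔭, W', C)` of `(W, p)` with points
`P ∈ E(ℚ)`, `P' ∈ E'(ℚ)` of infinite order, for every anticyclotomic datum `D` (any `κ, γ, ι, φ, Ω, 𝓔`) with a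
bottom index exponent `c` over `𝒪_𝔭 · z(𝟙)` (`D.HasBottomIndexExpZp c`), GRANTED F2
(`endRing_twoGenerated`): `S_{p,rel}(E/K) ≤ E(K) ⊗ ℤ_p` at the bottom layer. The two-generator descent
(p477771) over `padicPi`, fed with §2 (saturation, no Ш), §3 (two independent Mordell–Weil classes), §4
(the expansion from `hcZp` and F2). No GZK, no `Ш`, no duality, no reciprocity law is used.
[cite: PerrinRiou1987BSMF, §0 pp. 401–402] [cite: SilvermanAEC2009, Cor. III.9.4 and Exercise 10.16] -/
theorem relaxed_le_mordellWeilKummerSpan_of_endTwoGenerated (hEnd : endRing_twoGenerated)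
    (W : WeierstrassCurve ℚ) [W.IsElliptic] [W.IsGloballyMinimal] (p : ℕ) [Fact p.Prime]
    {K : Type} [Field K] [NumberField K] {𝔭 : HeightOneSpectrum (𝓞 K)}
    {W' : WeierstrassCurve ℚ} [W'.IsElliptic] [W'.IsGloballyMinimal] {C : VariableChange ℚ}
    (hF : X12.O11.IsFrame W p K 𝔭 W' C) {P : W.toAffine.Point} (hP : ¬ IsOfFinAddOrder P)
    {P' : W'.toAffine.Point} (hP' : ¬ IsOfFinAddOrder P') (κ : ZpExtension K p)
    {γ : absoluteGaloisGroup K} {ι : PadicAlgCl p ≃+* ℂ} {φ : HeckeCharacter K} {Ω : ℂ}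
    {𝓔 : AcDualExpSystem W p K 𝔭 κ ι} (D : EllipticUnitClassData W p K 𝔭 κ γ ι φ Ω 𝓔) {c : ℕ}
    (hc : D.HasBottomIndexExpZp c) :
    (W.baseChange K).relaxedCompactSelmerOver (κ.layerSubgroup 0) p {𝔭} ≤
      (W.baseChange K).mordellWeilKummerSpan p (κ.layerSubgroup 0) := by
  set V := W.baseChange K with hV
  set H := κ.layerSubgroup 0 with hHdef
  have hH : H = ⊤ := ZpExtension.layerSubgroup_zero κ
  -- the two `End_K(E)`-generators (F2)
  obtain ⟨φ₁, hφ₁, φ₂, hφ₂, hgen⟩ := hEnd K V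
  have hgen' : ∀ ψ ∈ V.endRing, ∃ a b : ℤ, ∀ Q : V.geomPoints, ψ Q = a • φ₁ Q + b • φ₂ Q := by
    intro ψ hψ
    obtain ⟨a, b, rfl⟩ := hgen ψ hψ
    exact ⟨a, b, fun Q ↦ rfl⟩
  -- the laws of the `ℤ_p`-action
  have h1 : ∀ z : V.torsionH1Pi p H, V.padicPi p H 1 z = z := padicPi_one V p H
  have hmul : ∀ (a b : ℤ_[p]) (z : V.torsionH1Pi p H), V.padicPi p H (a * b) z = V.padicPi p H a (V.padicPi p H b z) :=
    fun a b z ↦ (padicPi_padicPi V p H a b z).symm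
  have hadd := BottomLocalIndexSplit.padicPi_add V p H
  -- the two independent Mordell–Weil classes (§3)
  obtain ⟨m₁, hm₁, m₂, hm₂, hind⟩ := exists_pair_indep W p hF hP hP' H hH
  -- Mordell–Weil at the bottom layer
  have hfg : Module.Finite ℤ (V.fixedGeomPoints H) := moduleFinite_fixedGeomPoints_top V H hH
  refine TwoGeneratorDescent.le_of_twoGenerator_descent (V.padicPi p H) h1 hmul hadd
    (V.relaxedCompactSelmerOver H p {𝔭}) (V.mordellWeilKummerSpan p H)
    (KummerFamiliesSelmer.mordellWeilKummerSpan_le_relaxedCompactSelmerOver V p κ {𝔭})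
    (fun a x hx ↦ BottomLocalIndexSplit.padicPi_mem_mordellWeilKummerSpan V p H a hx)
    (fun x hx n hn hnx ↦ ?_) (V.endPi hφ₁ p H (D.z 0)) (V.endPi hφ₂ p H (D.z 0)) c (fun a ha ↦ ?_)
    m₁ m₂ hm₁ hm₂ hind
  · -- saturation (§2)
    exact mem_mordellWeilKummerSpan_of_zsmul_mem V p H hfg (mem_relaxedCompactSelmerOver_iff.1 hx).2
      (N := (n : ℤ)) (Int.natCast_ne_zero.2 hn) (by rwa [natCast_zsmul])
  · -- the expansion from the bottom index exponent (§4)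
    have hrel : (AddCommGroup.torsion (V.torsionH1Pi p H) ⊔ V.padicEndSpan p H (D.z 0)).relIndex
        (V.relaxedCompactSelmerOver H p {𝔭}) = p ^ c := hc
    have hmem := AddSubgroup.nsmul_relIndex_mem
      (AddCommGroup.torsion (V.torsionH1Pi p H) ⊔ V.padicEndSpan p H (D.z 0)) ha
    rw [hrel] at hmem
    obtain ⟨t, ht, y, hy, hty⟩ := AddSubgroup.mem_sup.1 hmem
    obtain ⟨u, v, rfl⟩ := exists_eq_padicPi_add_of_mem_padicEndSpan V p H hφ₁ hφ₂ hgen' (D.z 0) hy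
    exact ⟨t, (AddCommGroup.mem_torsion _).1 ht, u, v, by rw [← hty, add_assoc]⟩

/-- **The typed stub body at every prime, modulo F2: `X12.O11.RamifiedCMBottomSaturationAtZp W p` holds
for every globally minimal `W/ℚ` and every prime `p`, GRANTED `endRing_twoGenerated`** — of the binders
only the frame, `P`, `P'` (infinite order) and `hcZp` are used. [cite: PerrinRiou1987BSMF, §0 pp. 401–402]
[cite: SilvermanAEC2009, Cor. III.9.4] -/
theorem ramifiedCMBottomSaturationAtZp_of_endTwoGenerated (hEnd : endRing_twoGenerated)
    (W : WeierstrassCurve ℚ) [W.IsElliptic] [W.IsGloballyMinimal] (p : ℕ) [Fact p.Prime] :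
    X12.O11.RamifiedCMBottomSaturationAtZp W p := by
  intro K _ _ 𝔭 W' _ _ C hF _ κ _ γ _ P n P' n' hP _ _ _ _ hP' _ _ _ _ q q' _ _ ι φ Ω 𝓔 D c _ _ hc _ m _ _
  exact relaxed_le_mordellWeilKummerSpan_of_endTwoGenerated hEnd W p hF hP hP' κ D hc

end Assembly

end BottomSaturationRank

/-- **Stub S_sat-Zp of the line `rubin-formula-zp` on crux `EllipticUnitValueSevenOfGZK`
(stmt-BirchSwinnertonDyer-19945), MODULO F2** (`endRing_twoGenerated`, Silverman AEC Cor. III.9.4,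
statement-only named fact of the tree): `F2 → GZK → ∀ W ∈ 𝒞₇, X12.O11.RamifiedCMBottomSaturationAtZp W 7`.
The GZK antecedent of the registered stub `stub_bottomSaturationSevenZpOfGZK` is NOT used (nor is the class
hypothesis); the registered stub itself stays OPEN until F2 is either proved in the tree or threaded into
the crux's antecedent by the planner. BSD is not claimed. [cite: SilvermanAEC2009, Cor. III.9.4]
[cite: PerrinRiou1987BSMF, §0 pp. 401–402] -/
theorem bottomSaturationSevenZp_of_endTwoGenerated (hEnd : endRing_twoGenerated) :
    Literature.NumberTheory.EllipticCurves.rank_eq_analyticRank_of_analyticRank_le_one →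
    ∀ (W : WeierstrassCurve ℚ) [W.IsElliptic] [W.IsGloballyMinimal] [Fact (Nat.Prime 7)],
      X12.ClassCSeven W → X12.O11.RamifiedCMBottomSaturationAtZp W 7 :=
  fun _ W _ _ _ _ ↦ BottomSaturationRank.ramifiedCMBottomSaturationAtZp_of_endTwoGenerated hEnd W 7


end Summit.BirchSwinnertonDyer.BirchSwinnertonDyer.Theorems.RamifiedSevenEllipticUnits

end
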